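/-
Copyright: lit-balaban cell (HOME `run/shared/lean/pub/lit-balaban/`), Phase-2 proof seat p12 (gen 7).  The proofs reproduce the
printed arguments; nothing is claimed beyond what the kernel checks below.
-/
import Literature.MathematicalPhysics.QuantumFieldTheory.DybalskiStottmeisterTanimoto2024.DST24Configurations

/-!
# `DybalskiStottmeisterTanimoto2024.DST24LinearConstraint` — [DybalskiStottmeisterTanimoto2024] **§2.1 «Linearization of the
# constraint»**, displays (2.2)–(2.6) PROVED: `c′(U′)(y)`, the linearized constraint `Σ_{x∈B(y)} A⃗(x) = 0`, the averaging map `Q`,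
# its adjoint `Q*` and «`Q*Q` is the projection on block-constant functions»

statement-level skeleton of published theorems with citation tags; proofs where landed; nothing here is a claim about
the Yang–Mills mass gap

W. Dybalski, A. Stottmeister, Y. Tanimoto, *The Bałaban variational problem in the non-linear sigma model*, Rev. Math. Phys.
**36** (2024), arXiv:2403.09800; source held `paper:arxiv-2403.09800` (§2.1 = tex chunk p0007; Notation = p0005).  Unit
`lit-balaban-p12` (gen 7); carrier and dictionary in `DST24Setting` (`A⃗ = −Im q ∈ Im ℍ ≅ ℝ³`), §2.2 in `DST24Configurations`.

WHAT IS PRINTED (§2.1) AND PROVED HERE.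
* (2.2) «`c′(U′)(y) := 2i Im 𝒞₀(U′)(y) = 0`», (2.3) «`c′(U′)(y) = Σ_{x∈B(y)} (U′(x) − U′(x)*) = 0`» — `cPrime` (:= (2.3)),
  `cPrime_eq` ((2.3) `= −2 Σ_x A⃗(x)` as quaternions, i.e. (2.2) up to the factor `L²` the print drops between the two displays),
  `cPrime_eq_zero_iff`.
* «the second relation in (2.1) is equivalent to `Re 𝒞₀(U′) ≥ 0` and `Im 𝒞₀(U′) = 0`» and (2.4) «`Σ_{x∈B(y)} A⃗(x) = 0`, `δ = 1`,
  thus we linearized the constraint» — `sum_vecOf_eq_zero_of_constraint` (constraint ⇒ (2.4)) and the converse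
  `constraint_of_sum_vecOf_eq_zero` (under `δ = 1` on the block), hence `constraint_iff_sum_vecOf_eq_zero`.
* (2.5) «`(Qf)(y) := L⁻² Σ_{x∈B(y)} f(x)`», «to state the constraint (2.4) as `Q(A⃗) = 0`» — `Q`, `C0_eq_Q`, `Q_eq_zero_iff`;
  (2.6) «`(Q*f)(x) = f(y_x)`, `(Q*Qf)(x) = L⁻² Σ_{x′∈B(y_x)} f(x′)`, i.e. `Q*Q` is the projection on block-constant functions» with the
  scalar products of the Notation section `⟨f,f′⟩_Ω = Σ_x f·f′`, `⟨g,g′⟩_{Ω₁} = L² Σ_y g·g′` — `Qstar`, `ipS`/`ipC`, `ipC_Q_eq_ipS_Qstar`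
  (`Q*` IS the adjoint), `Qstar_Q_apply` ((2.6)), `Q_Qstar` (`QQ* = 1`), `Qstar_Q_Qstar_Q` (idempotent), `Qstar_Q_eq_self_iff`
  (range = block-constant functions).
-/

namespace Literature.MathematicalPhysics.QuantumFieldTheory.DybalskiStottmeisterTanimoto2024.DST24LinearConstraint

open scoped Quaternion RealInnerProductSpace BigOperators
open Literature.MathematicalPhysics.QuantumFieldTheory.Federbush1986
open Literature.MathematicalPhysics.QuantumFieldTheory.DybalskiStottmeisterTanimoto2024.DST24Setting
open Literature.MathematicalPhysics.QuantumFieldTheory.DybalskiStottmeisterTanimoto2024.DST24Configurations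

noncomputable section

variable {L n₁ : ℕ}

/-! ## (2.2)–(2.4): `c′(U′)(y)` and the linearized constraint `Σ_{x∈B(y)} A⃗(x) = 0` -/

/-- `c′(U′)(y) = Σ_{x∈B(y)} (U′(x) − U′(x)*)` ((2.3); = `2i Im 𝒞₀(U′)(y)` of (2.2) up to the factor `L²`).
[cite: DybalskiStottmeisterTanimoto2024, §2.1 (2.2)–(2.3) (intermediate-constraint)] -/
def cPrime (U' : Conf L n₁) (y : CSite n₁) : ℍ := ∑ x ∈ box L y, ((U' x).val - star (U' x).val)

/-- `q − q* = 2 Im q = −2A⃗` (`A⃗ = −Im q`). [cite: DybalskiStottmeisterTanimoto2024, §2.1 (2.2)–(2.3)] -/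
theorem sub_star_eq (q : ℍ) : q - star q = (-2 : ℝ) • (vecOf q : ℍ) := by
  rw [vecOf_coe, smul_neg, neg_smul, neg_neg, two_smul]
  ext <;> simp

/-- (2.3) in the vector variables: `c′(U′)(y) = −2 Σ_{x∈B(y)} A⃗(x)`. [cite: DybalskiStottmeisterTanimoto2024, §2.1 (2.3)–(2.4)] -/
theorem cPrime_eq (U' : Conf L n₁) (y : CSite n₁) :
    cPrime U' y = (-2 : ℝ) • ((∑ x ∈ box L y, vecOf (U' x).val : su2) : ℍ) := by
  unfold cPrime
  rw [Submodule.coe_sum, Finset.smul_sum]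
  exact Finset.sum_congr rfl fun x _ => sub_star_eq _

/-- `c′(U′)(y) = 0 ⇔ Σ_{x∈B(y)} A⃗(x) = 0`. [cite: DybalskiStottmeisterTanimoto2024, §2.1 (2.3) ⇒ (2.4)] -/
theorem cPrime_eq_zero_iff (U' : Conf L n₁) (y : CSite n₁) :
    cPrime U' y = 0 ↔ ∑ x ∈ box L y, vecOf (U' x).val = 0 := by
  rw [cPrime_eq, smul_eq_zero, or_iff_right (by norm_num : (-2 : ℝ) ≠ 0), Submodule.coe_eq_zero]

/-- `Im 𝒞₀(U′)(y)` in the vector variables: `L² Im 𝒞₀(U′)(y) = −Σ_{x∈B(y)} A⃗(x)`. [cite: DybalskiStottmeisterTanimoto2024, §2.1 (2.2), (2.4)] -/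
theorem im_C0_eq (hL : 0 < L) (U' : Conf L n₁) (y : CSite n₁) :
    ((L : ℝ) ^ 2) • (C0 U' y).im = -((∑ x ∈ box L y, vecOf (U' x).val : su2) : ℍ) := by
  have hL' : ((L : ℝ) ^ 2) ≠ 0 := by positivity
  unfold C0
  rw [Quaternion.im_smul, smul_smul, mul_inv_cancel₀ hL', one_smul, Submodule.coe_sum, ← Finset.sum_neg_distrib]
  -- `Im` is additive: push it through the sum
  induction (box L y) using Finset.induction_on with
  | empty => simp
  | insert a s ha ih => rw [Finset.sum_insert ha, Finset.sum_insert ha, Quaternion.im_add, ih, vecOf_coe, neg_neg]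

/-- **Constraint ⇒ (2.4)**: if `𝒞(U)(y) = V(y)` (with `𝒞₀(U)(y) ≠ 0`, the regime of the text), then `Im 𝒞₀(U′)(y) = 0`, i.e.
`Σ_{x∈B(y)} A⃗(x) = 0` for `U′ = UV(y_x)⁻¹`. [cite: DybalskiStottmeisterTanimoto2024, §2.1 (2.1) ⇒ (2.4)] -/
theorem sum_vecOf_eq_zero_of_constraint (hL : 0 < L) {U : Conf L n₁} {V : CConf n₁} {y : CSite n₁} (h0 : C0 U y ≠ 0)
    (hC : avg U y = V y) : ∑ x ∈ box L y, vecOf (Uprime U V x).val = 0 := by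
  have hreal := (constraint_iff_C0_real h0).mp hC
  have him : (C0 (Uprime U V) y).im = 0 := by rw [hreal, Quaternion.im_coe]
  have h := im_C0_eq hL (Uprime U V) y
  rw [him, smul_zero, eq_comm, neg_eq_zero] at h
  exact Submodule.coe_eq_zero.mp h

/-- **(2.4) ⇒ constraint** under `δ = 1` on the block («The condition `Re 𝒞₀(U′) ≥ 0` is satisfied automatically for `U′` close
enough to the identity»): if `Σ_{x∈B(y)} A⃗(x) = 0` and `Re U′(x) > 0` for `x ∈ B(y)` (`L ≥ 1`), then `𝒞₀(U′)(y)` is a positive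
real and `𝒞(U)(y) = V(y)`. [cite: DybalskiStottmeisterTanimoto2024, §2.1 (2.4) and the sentence before (2.2)] -/
theorem constraint_of_sum_vecOf_eq_zero (hL : 0 < L) {U : Conf L n₁} {V : CConf n₁} {y : CSite n₁}
    (hpos : ∀ x ∈ box L y, 0 < (Uprime U V x).val.re) (hsum : ∑ x ∈ box L y, vecOf (Uprime U V x).val = 0) :
    avg U y = V y := by
  have hLr : (0 : ℝ) < L := by exact_mod_cast hL
  -- `Im 𝒞₀(U′) = 0`
  have him : (C0 (Uprime U V) y).im = 0 := by
    have h := im_C0_eq hL (Uprime U V) y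
    rw [hsum, Submodule.coe_zero, neg_zero] at h
    exact (smul_eq_zero.mp h).resolve_left (by positivity)
  -- `Re 𝒞₀(U′) > 0`
  have hre : 0 < (C0 (Uprime U V) y).re := by
    unfold C0
    rw [Quaternion.re_smul, smul_eq_mul]
    refine mul_pos (by positivity) ?_
    have hne : (box L y).Nonempty := by
      rw [← Finset.card_pos, card_box]; positivity
    -- `Re` is additive: push it through the sum
    have : ∀ s : Finset (Site L n₁), (∑ x ∈ s, (Uprime U V x).val).re = ∑ x ∈ s, (Uprime U V x).val.re := by
      intro s
      induction s using Finset.induction_on with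
      | empty => simp
      | insert a s ha ih => rw [Finset.sum_insert ha, Finset.sum_insert ha, Quaternion.re_add, ih]
    rw [this]
    exact Finset.sum_pos hpos hne
  -- hence `𝒞₀(U′) = ‖𝒞₀(U′)‖` (a positive real), and `𝒞₀(U) ≠ 0`
  have hq : C0 (Uprime U V) y = ((‖C0 (Uprime U V) y‖ : ℝ) : ℍ) := by
    have h1 : C0 (Uprime U V) y = (((C0 (Uprime U V) y).re : ℝ) : ℍ) := by
      have := Quaternion.re_add_im (C0 (Uprime U V) y)
      rw [him, add_zero] at this
      exact this.symm
    have h2 : ‖C0 (Uprime U V) y‖ = (C0 (Uprime U V) y).re := by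
      rw [h1, Quaternion.norm_coe, Real.norm_eq_abs, abs_of_pos hre, Quaternion.re_coe]
    rw [h2]; exact h1
  have h0 : C0 U y ≠ 0 := by
    intro h
    have := norm_C0_Uprime U V y
    rw [h, norm_zero] at this
    rw [this, Quaternion.coe_zero] at hq
    rw [hq, Quaternion.re_zero] at hre
    exact lt_irrefl _ hre
  exact (constraint_iff_C0_real h0).mpr hq

/-- In the regime of Theorem (configurations-theorem) the constraint IS the linear condition (2.4): for `U ∈ Conf_ε(Ω)`,
`0 < ε`, `4c_{1/2}Lε ≤ 1`: `𝒞(U) = V ⇔ ∀ y, Σ_{x∈B(y)} A⃗(x) = 0` (with `U′ = UV(y_x)⁻¹`; the forward direction needs only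
`ε ≤ 1/(4L)`, the backward one `δ = 1`, which Theorem (configurations-theorem) provides once the constraint holds — so the
equivalence is stated for `U′ ∈ Conf^{ε′}(Ω)`, `ε′ ≤ 1`, as in §4.1 «by reversing the steps in Subsection 2.1»).
[cite: DybalskiStottmeisterTanimoto2024, §2.1 (2.1)⇔(2.4); §4.1 (The space X_ε)] -/
theorem constraint_iff_sum_vecOf_eq_zero (hL : 0 < L) {ε ε' : ℝ} (hε : 0 ≤ ε) (hεL : ε ≤ 1 / (4 * L)) (hε' : ε' < 1)
    {U : Conf L n₁} (hU : U ∈ smallField ε) {V : CConf n₁} (hU' : Uprime U V ∈ nearOne ε') :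
    avg U = V ↔ ∀ y, ∑ x ∈ box L y, vecOf (Uprime U V x).val = 0 := by
  constructor
  · intro hC y
    exact sum_vecOf_eq_zero_of_constraint hL (C0_ne_zero hL hε hεL hU y) (congrFun hC y)
  · intro h
    funext y
    refine constraint_of_sum_vecOf_eq_zero hL (fun x _ => ?_) (h y)
    -- `‖U′(x) − 1‖ ≤ ε′ < 1 ⇒ Re U′(x) > 0`
    have h1 := hU' x
    have h2 := norm_val_sub_one_sq (Uprime U V x)
    have h3 : ‖(Uprime U V x).val - 1‖ ^ 2 < 1 := by
      have := norm_nonneg ((Uprime U V x).val - 1)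
      nlinarith
    nlinarith

/-! ## (2.5)–(2.6): the averaging map `Q`, its adjoint `Q*`, and the projection `Q*Q` -/

section Q

variable {M : Type*}

/-- (2.6) «`(Q*f)(x) = f(y_x)`». [cite: DybalskiStottmeisterTanimoto2024, §2.1 (2.6) (Q-properties)] -/
def Qstar (L : ℕ) (g : CSite n₁ → M) : Site L n₁ → M := fun x => g (blk x)

/-- [cite: DybalskiStottmeisterTanimoto2024, §2.1 (2.6)] -/
theorem Qstar_apply (g : CSite n₁ → M) (x : Site L n₁) : Qstar L g x = g (blk x) := rfl

variable [AddCommGroup M] [Module ℝ M]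

/-- (2.5) «`(Qf)(y) := L⁻² Σ_{x∈B(y)} f(x)`», a linear averaging map `𝓛²(Ω;ℝ^ℓ) → 𝓛²(Ω₁;ℝ^ℓ)` (any real vector space of values).
[cite: DybalskiStottmeisterTanimoto2024, §2.1 (2.5) (linear-averaging)] -/
def Q (L : ℕ) (f : Site L n₁ → M) : CSite n₁ → M := fun y => ((L : ℝ) ^ 2)⁻¹ • ∑ x ∈ box L y, f x

/-- [cite: DybalskiStottmeisterTanimoto2024, §2.1 (2.5)] -/
theorem Q_apply (f : Site L n₁ → M) (y : CSite n₁) : Q L f y = ((L : ℝ) ^ 2)⁻¹ • ∑ x ∈ box L y, f x := rfl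

/-- `𝒞₀ = Q` applied to the matrix entries: `𝒞₀(U)(y) = (Q U)(y)` in `ℍ`. [cite: DybalskiStottmeisterTanimoto2024, §1.1 (𝒞₀) and §2.1 (2.5)] -/
theorem C0_eq_Q (U : Conf L n₁) (y : CSite n₁) : C0 U y = Q L (fun x => (U x).val) y := rfl

/-- `Q` is additive. [cite: DybalskiStottmeisterTanimoto2024, §2.1 (2.5) («linear averaging map»)] -/
theorem Q_add (f f' : Site L n₁ → M) : Q L (f + f') = Q L f + Q L f' := by
  funext y; simp [Q_apply, Finset.sum_add_distrib, smul_add]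

/-- `Q` is homogeneous. [cite: DybalskiStottmeisterTanimoto2024, §2.1 (2.5) («linear averaging map»)] -/
theorem Q_smul (c : ℝ) (f : Site L n₁ → M) : Q L (c • f) = c • Q L f := by
  funext y; simp [Q_apply, Finset.smul_sum, smul_comm c]

/-- The constraint (2.4) as «`Q(A⃗) = 0`». [cite: DybalskiStottmeisterTanimoto2024, §2.1 (2.4)–(2.5)] -/
theorem Q_eq_zero_iff (hL : 0 < L) (f : Site L n₁ → M) (y : CSite n₁) : Q L f y = 0 ↔ ∑ x ∈ box L y, f x = 0 := by
  rw [Q_apply, smul_eq_zero, or_iff_right]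
  exact inv_ne_zero (by positivity)

/-- **(2.6)** «`(Q*Qf)(x) = L⁻² Σ_{x′∈B(y_x)} f(x′)`». [cite: DybalskiStottmeisterTanimoto2024, §2.1 (2.6) (Q-properties)] -/
theorem Qstar_Q_apply (f : Site L n₁ → M) (x : Site L n₁) :
    Qstar L (Q L f) x = ((L : ℝ) ^ 2)⁻¹ • ∑ x' ∈ box L (blk x), f x' := rfl

/-- `QQ* = 1` (used in §4.2: «since `QQ* = 1`»). [cite: DybalskiStottmeisterTanimoto2024, §2.1 (2.6); §4.2 proof of Lemma (inverse-lemma) («QQ* = 1»)] -/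
theorem Q_Qstar (hL : 0 < L) (g : CSite n₁ → M) : Q L (Qstar L g) = g := by
  funext y
  rw [Q_apply]
  have : ∑ x ∈ box L y, Qstar L g x = ∑ _x ∈ box L y, g y :=
    Finset.sum_congr rfl fun x hx => by rw [Qstar_apply, mem_box.mp hx]
  rw [this, Finset.sum_const, card_box, ← Nat.cast_smul_eq_nsmul ℝ, smul_smul]
  have h : ((L : ℝ) ^ 2)⁻¹ * ((L ^ 2 : ℕ) : ℝ) = 1 := by
    push_cast; exact inv_mul_cancel₀ (by positivity)
  rw [h, one_smul]

/-- «`Q*Q` is the projection on block-constant functions»: idempotence. [cite: DybalskiStottmeisterTanimoto2024, §2.1 (2.6)] -/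
theorem Qstar_Q_Qstar_Q (hL : 0 < L) (f : Site L n₁ → M) : Qstar L (Q L (Qstar L (Q L f))) = Qstar L (Q L f) := by
  rw [Q_Qstar hL]

/-- «`Q*Q` is the projection on block-constant functions»: its fixed points are exactly the block-constant functions.
[cite: DybalskiStottmeisterTanimoto2024, §2.1 (2.6)] -/
theorem Qstar_Q_eq_self_iff (hL : 0 < L) (f : Site L n₁ → M) :
    Qstar L (Q L f) = f ↔ ∃ g : CSite n₁ → M, f = Qstar L g := by
  constructor
  · intro h; exact ⟨Q L f, h.symm⟩
  · rintro ⟨g, rfl⟩; rw [Q_Qstar hL]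

end Q

section Adjoint

variable {M : Type*} [NormedAddCommGroup M] [InnerProductSpace ℝ M]

/-- `⟨f, f′⟩_Ω = Σ_{x∈Ω} f(x)·f′(x)` (Notation). [cite: DybalskiStottmeisterTanimoto2024, §1 Notation (scalar products)] -/
def ipS (f f' : Site L n₁ → M) : ℝ := ∑ x, ⟪f x, f' x⟫

/-- `⟨g, g′⟩_{Ω₁} = L² Σ_{y∈Ω₁} g(y)·g′(y)` (Notation, `d = 2`). [cite: DybalskiStottmeisterTanimoto2024, §1 Notation (scalar products)] -/
def ipC (L : ℕ) (g g' : CSite n₁ → M) : ℝ := (L : ℝ) ^ 2 * ∑ y, ⟪g y, g' y⟫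

/-- **`Q*` is the adjoint of `Q`**: `⟨Qf, g⟩_{Ω₁} = ⟨f, Q*g⟩_Ω` (the defining relation of (2.6)).
[cite: DybalskiStottmeisterTanimoto2024, §2.1 (2.6) (Q-properties); §3.3 (adjoint)] -/
theorem ipC_Q_eq_ipS_Qstar (hL : 0 < L) (f : Site L n₁ → M) (g : CSite n₁ → M) :
    ipC L (Q L f) g = ipS f (Qstar L g) := by
  unfold ipC ipS
  rw [sum_eq_sum_box (fun x => ⟪f x, Qstar L g x⟫), Finset.mul_sum]
  refine Finset.sum_congr rfl fun y _ => ?_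
  rw [Q_apply, real_inner_smul_left, sum_inner, ← mul_assoc, mul_inv_cancel₀ (by positivity), one_mul]
  exact Finset.sum_congr rfl fun x hx => by rw [Qstar_apply, mem_box.mp hx]

/-- `Q*Q` is symmetric for `⟨·,·⟩_Ω` (an orthogonal projection). [cite: DybalskiStottmeisterTanimoto2024, §2.1 (2.6)] -/
theorem ipS_Qstar_Q_symm (hL : 0 < L) (f f' : Site L n₁ → M) :
    ipS (Qstar L (Q L f)) f' = ipS f (Qstar L (Q L f')) := by
  rw [← ipC_Q_eq_ipS_Qstar hL]
  unfold ipC ipS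
  rw [sum_eq_sum_box (fun x => ⟪Qstar L (Q L f) x, f' x⟫), Finset.mul_sum]
  refine Finset.sum_congr rfl fun y _ => ?_
  have : ∑ x ∈ box L y, ⟪Qstar L (Q L f) x, f' x⟫ = ⟪Q L f y, ∑ x ∈ box L y, f' x⟫ := by
    rw [inner_sum]
    exact Finset.sum_congr rfl fun x hx => by rw [Qstar_apply, mem_box.mp hx]
  rw [this, Q_apply (f := f'), real_inner_smul_right, ← mul_assoc, mul_inv_cancel₀ (by positivity), one_mul]

end Adjoint

end

end Literature.MathematicalPhysics.QuantumFieldTheory.DybalskiStottmeisterTanimoto2024.DST24LinearConstraint
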